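import Literature.MathematicalPhysics.QuantumFieldTheory.WightmanClusterLorentz
import Literature.MathematicalPhysics.QuantumFieldTheory.OSDistributionSpaceCluster
import HarnessLib

/-!
# The cluster property of the OS boundary values from the cluster property in vector form

Topic `Literature/MathematicalPhysics/QuantumFieldTheory`; second step in the decomposition of
the named fact `Literature.MathematicalPhysics.QuantumFieldTheory.OS1973_cluster` (conjunct
(A₃, R4) of `OS1973_isWightmanFamily_of_continuation`, `WightmanProofs`), after
`WightmanClusterLorentz` (space-like directions reduced to spatial ones by Lorentz invariance).

Osterwalder–Schrader I (CMP 31 (1973)), §4.4, p. 96–97: the Euclidean cluster property (E4)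
becomes, "in vector notation" and "by continuity", eq. (4.30)
`lim_{λ→∞} (u(h), U_s(λa) u(k))_ℋ = (u(h), Ω)_ℋ (Ω, u(k))_ℋ` for all vectors of the physical
Hilbert space `ℋ` of §4.1, and "Eq. (4.30) is the cluster property (R4) in vector notation" — the
translation back to the Wightman distributions being the map `u` of §4.3, (4.26)–(4.27), from
(sequences of) Minkowski test functions into `ℋ` with
`∑ₙₘ 𝒲ₙ₊ₘ(fₙ* × fₘ) = (u(f), u(f))_ℋ` (4.28). The tree has (4.30) for the distributional OS
Hilbert space (`OSSpace.tendsto_inner_spaceShiftH`, `OSDistributionSpaceCluster`); the map `u` is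
the content of §4.3 (Lemmas 4.1–4.2: Fourier–Laplace transforms of Euclidean test functions are
dense, and the OS scalar product is continuous in their topology). This file proves the
translation step **for any such map**, abstractly:

* `WightmanFamily.hasSpatialClusterProperty_of_vectors` — let `𝒲` be a hermitian family of
  distributions (one scalar field), `ℋ` a complex inner product space with a vector `Ω`, operators
  `U(a)`, `a` spatial, clustering weakly to `Ω` as in (4.30), and `u : 𝓢((ℝ^{1+d})^m) → ℋ`
  (each `m`) with `⟪u F, u G⟫ = 𝒲ₙ₊ₘ(F* ⊗ G)` (polarised (4.28)), `u(G(· − a)) = U(a) u(G)` and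
  `⟪Ω, u G⟫ = 𝒲ₘ(G)`; then `𝒲` has the spatial cluster property
  (`HasSpatialClusterProperty`): `𝒲ₙ₊ₘ(F ⊗ G_{(λa)}) = ⟪u(F*), U(λa) u(G)⟫ → ⟪u(F*), Ω⟫⟪Ω, u(G)⟫ =
  conj 𝒲ₙ(F*) · 𝒲ₘ(G) = 𝒲ₙ(F) 𝒲ₘ(G)` (hermiticity);
* `IsOSContinuationFamily.hasClusterProperty_of_vectors` — for an OS family `S` and its
  continuation family `𝒲`, any such `u` into the OS Hilbert space `OSHilbert S _` (with
  `U = spaceShiftH`, `Ω = vacuum`) gives the full cluster property (f) (with (4.30) of the tree,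
  hermiticity `IsOSContinuationFamily.isHermitianFamily` and Lorentz invariance,
  `IsOSContinuationFamily.hasClusterProperty_of_spatial`);
* `OS1973_cluster_of_vectors` — `OS1973_cluster` thus reduces to the existence of the Minkowski
  vectors `u` of OS I §4.3 for every OS family with E0' (the same input as positivity (R2),
  (4.28)).

## References

* K. Osterwalder, R. Schrader, *Axioms for Euclidean Green's functions*, Comm. Math. Phys. 31
  (1973) 83–112, §4.3 eqs. (4.26)–(4.28), §4.4 eqs. (4.29)–(4.30). [OsterwalderSchraderCMP1973]
* R. F. Streater, A. S. Wightman, *PCT, Spin and Statistics, and All That* (1964), §3-4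
  eq. (3-31). [StreaterWightman1964]
-/

noncomputable section

open Filter Topology ComplexConjugate
open scoped SchwartzMap InnerProductSpace
open Literature.MathematicalPhysics.QuantumLattice Literature.Analysis.FunctionSpaces

namespace Literature.MathematicalPhysics.QuantumFieldTheory

variable {d : ℕ}

/-- The involution `F ↦ F*`, `F*(x₁, …, xₙ) = conj F(xₙ, …, x₁)`, is an involution. [folklore] -/
theorem starTest_permTest_revPerm_involutive {n : ℕ} (F : 𝓢((Fin n → SpaceTime d), ℂ)) :
    starTest (permTest Fin.revPerm (starTest (permTest Fin.revPerm F))) = F := by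
  ext x
  simp only [starTest_apply, permTest_apply, Complex.conj_conj]
  congr 1
  funext i
  simp [Function.comp_apply, Fin.revPerm_apply, Fin.rev_rev]

/-- **(R4) from (4.30) and the Minkowski vectors, abstractly.** Let `𝒲` be a hermitian family
of distributions of one scalar field, `H` a complex inner product space, `Ω ∈ H`, `U(a)` (`a`
spatial) bounded operators with `⟪φ, U(ta) ψ⟫ → ⟪φ, Ω⟫⟪Ω, ψ⟫` (`t → ∞`) for every nonzero spatial
`a` and all `φ, ψ` (OS I (4.30)), and `u` a map from `m`-point Minkowski test functions into `H`
(every `m`) with the Gram identity `⟪u F, u G⟫ = 𝒲ₙ₊ₘ(F* ⊗ G)` (polarised (4.28); tensor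
products in witness form), covariance `u(G(· − a)) = U(a) u(G)` under spatial translations and
vacuum components `⟪Ω, u G⟫ = 𝒲ₘ(G)`. Then `𝒲` has the cluster property along spatial
directions. [cite: OsterwalderSchraderCMP1973, §4.4 eqs. (4.29)–(4.30)] -/
theorem _root_.Literature.Analysis.FunctionSpaces.WightmanFamily.hasSpatialClusterProperty_of_vectors
    {𝒲 : WightmanFamily d Unit} (hherm : IsHermitianFamily 𝒲)
    {H : Type*} [NormedAddCommGroup H] [InnerProductSpace ℂ H] (Ω : H)
    (U : (a : SpaceTime d) → a 0 = 0 → H →L[ℂ] H)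
    (hU : ∀ (a : SpaceTime d) (ha : a 0 = 0), a ≠ 0 → ∀ (h : ∀ t : ℝ, (t • a) 0 = 0) (φ ψ : H),
      Tendsto (fun t : ℝ => ⟪φ, U (t • a) (h t) ψ⟫_ℂ) atTop (𝓝 (⟪φ, Ω⟫_ℂ * ⟪Ω, ψ⟫_ℂ)))
    (u : (n : ℕ) → 𝓢((Fin n → SpaceTime d), ℂ) → H)
    (hGram : ∀ (n m : ℕ) (F : 𝓢((Fin n → SpaceTime d), ℂ)) (G : 𝓢((Fin m → SpaceTime d), ℂ))
      (K : 𝓢((Fin (n + m) → SpaceTime d), ℂ)),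
      IsAppendTensorOf K (starTest (permTest Fin.revPerm F)) G →
        ⟪u n F, u m G⟫_ℂ = 𝒲 (n + m) (fun _ => ()) K)
    (hcov : ∀ (m : ℕ) (a : SpaceTime d) (ha : a 0 = 0) (G : 𝓢((Fin m → SpaceTime d), ℂ)),
      u m (translateMulti a G) = U a ha (u m G))
    (hvac : ∀ (m : ℕ) (G : 𝓢((Fin m → SpaceTime d), ℂ)), ⟪Ω, u m G⟫_ℂ = 𝒲 m (fun _ => ()) G) :
    HasSpatialClusterProperty 𝒲 := by
  intro n m kn km F G a ha0 hane Hw hHw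
  obtain rfl := unitLabels_eq kn
  obtain rfl := unitLabels_eq km
  have happ : (Fin.append (fun _ : Fin n => ()) (fun _ : Fin m => ())) = fun _ => () :=
    funext fun _ => rfl
  rw [happ]
  set F' : 𝓢((Fin n → SpaceTime d), ℂ) := starTest (permTest Fin.revPerm F) with hF'def
  have hF' : starTest (permTest Fin.revPerm F') = F := starTest_permTest_revPerm_involutive F
  have hsm : ∀ t : ℝ, (t • a) 0 = 0 := fun t => by simp [ha0]
  -- `𝒲(F ⊗ G_{ta}) = ⟪u F*, U(ta) u G⟫`
  have hval : ∀ t : ℝ, 𝒲 (n + m) (fun _ => ()) (Hw t) = ⟪u n F', U (t • a) (hsm t) (u m G)⟫_ℂ :=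
    fun t => by
      rw [← hcov]
      exact (hGram n m F' _ (Hw t) (by rw [hF']; exact hHw t)).symm
  -- the limit `⟪u F*, Ω⟫ ⟪Ω, u G⟫ = 𝒲ₙ(F) 𝒲ₘ(G)` by hermiticity
  have h1 : ⟪u n F', Ω⟫_ℂ = 𝒲 n (fun _ => ()) F := by
    rw [← inner_conj_symm, hvac]
    have hh := hherm n (fun _ => ()) F
    have hk : ((fun _ : Fin n => ()) ∘ Fin.rev) = fun _ => () := rfl
    rw [hk] at hh
    rw [← hF'def] at hh
    rw [hh, Complex.conj_conj]
  have e : (fun t : ℝ => 𝒲 (n + m) (fun _ => ()) (Hw t)) =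
      fun t => ⟪u n F', U (t • a) (hsm t) (u m G)⟫_ℂ := funext hval
  rw [e, ← h1, ← hvac m G]
  exact hU a ha0 hane hsm (u n F') (u m G)

/-! ### OS continuation families -/

variable {S : SchwingerFamily (EuclideanSpace ℝ (Fin (d + 1)))} {𝒲 : WightmanFamily d Unit}

/-- **Cluster property (f) of an OS continuation family from the Minkowski vectors.** For an OS
family `S` (E1, E2, E4 and `𝔖₀ = 1` used) and its continuation family `𝒲`, any map `u` from
Minkowski test functions into the OS Hilbert space `ℋ = OSHilbert S _` with the Gram identity
`⟪u F, u G⟫ = 𝒲ₙ₊ₘ(F* ⊗ G)`, spatial covariance `u(G(· − a)) = U_s(a) u(G)` (`spaceShiftH`) and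
vacuum components `⟪Ω, u G⟫ = 𝒲ₘ(G)` yields the cluster property: (4.30)
(`OSSpace.tendsto_inner_spaceShiftH`) gives it along spatial directions
(`hasSpatialClusterProperty_of_vectors`, hermiticity being `IsOSContinuationFamily.isHermitianFamily`),
and Lorentz invariance extends it to all space-like directions
(`IsOSContinuationFamily.hasClusterProperty_of_spatial`). [cite: OsterwalderSchraderCMP1973, §4.4 eqs. (4.29)–(4.30)] -/
theorem IsOSContinuationFamily.hasClusterProperty_of_vectors [NeZero d] (hOS : S.IsOSFamily)
    (h : IsOSContinuationFamily S 𝒲)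
    (u : (n : ℕ) → 𝓢((Fin n → SpaceTime d), ℂ) → SchwingerFamily.OSHilbert S hOS.reflectionPositive)
    (hGram : ∀ (n m : ℕ) (F : 𝓢((Fin n → SpaceTime d), ℂ)) (G : 𝓢((Fin m → SpaceTime d), ℂ))
      (K : 𝓢((Fin (n + m) → SpaceTime d), ℂ)),
      IsAppendTensorOf K (starTest (permTest Fin.revPerm F)) G →
        ⟪u n F, u m G⟫_ℂ = 𝒲 (n + m) (fun _ => ()) K)
    (hcov : ∀ (m : ℕ) (a : SpaceTime d) (ha : a 0 = 0) (G : 𝓢((Fin m → SpaceTime d), ℂ)),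
      u m (translateMulti a G) = SchwingerFamily.OSSpace.spaceShiftH hOS.reflectionPositive a ha (u m G))
    (hvac : ∀ (m : ℕ) (G : 𝓢((Fin m → SpaceTime d), ℂ)),
      ⟪SchwingerFamily.OSSpace.vacuum S hOS.reflectionPositive, u m G⟫_ℂ = 𝒲 m (fun _ => ()) G) :
    HasClusterProperty 𝒲 :=
  h.hasClusterProperty_of_spatial hOS.covariant
    (WightmanFamily.hasSpatialClusterProperty_of_vectors (h.isHermitianFamily hOS)
      (SchwingerFamily.OSSpace.vacuum S hOS.reflectionPositive)
      (fun a ha => SchwingerFamily.OSSpace.spaceShiftH hOS.reflectionPositive a ha)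
      (fun _ ha hne _ φ ψ =>
        SchwingerFamily.OSSpace.tendsto_inner_spaceShiftH hOS.covariant hOS.cluster ha hne φ ψ)
      u hGram hcov hvac)

/-- **`OS1973_cluster` reduces to the Minkowski vectors of OS I §4.3.** If for every OS family
`S` with E0' and its continuation family `𝒲` there is a map `u` from Minkowski test functions
into the OS Hilbert space with the Gram identity (4.28) (polarised), covariance under spatial
translations and the vacuum components `⟪Ω, u G⟫ = 𝒲ₘ(G)`, then `OS1973_cluster` holds — the
same input from which positivity (R2) follows by `⟪u f, u f⟫ ≥ 0`. Real proof. [cite: OsterwalderSchraderCMP1973, §4.3 eqs. (4.26)–(4.28) and §4.4 eq. (4.30)] -/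
theorem OS1973_cluster_of_vectors
    (hu : ∀ (d : ℕ) [NeZero d] (S : SchwingerFamily (EuclideanSpace ℝ (Fin (d + 1))))
      (hS : S.IsOSFamily), S.HasLinearGrowth → ∀ 𝒲 : WightmanFamily d Unit,
        IsOSContinuationFamily S 𝒲 →
        ∃ u : (n : ℕ) → 𝓢((Fin n → SpaceTime d), ℂ) → SchwingerFamily.OSHilbert S hS.reflectionPositive,
          (∀ (n m : ℕ) (F : 𝓢((Fin n → SpaceTime d), ℂ)) (G : 𝓢((Fin m → SpaceTime d), ℂ))
            (K : 𝓢((Fin (n + m) → SpaceTime d), ℂ)),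
            IsAppendTensorOf K (starTest (permTest Fin.revPerm F)) G →
              ⟪u n F, u m G⟫_ℂ = 𝒲 (n + m) (fun _ => ()) K) ∧
          (∀ (m : ℕ) (a : SpaceTime d) (ha : a 0 = 0) (G : 𝓢((Fin m → SpaceTime d), ℂ)),
            u m (translateMulti a G) =
              SchwingerFamily.OSSpace.spaceShiftH hS.reflectionPositive a ha (u m G)) ∧
          (∀ (m : ℕ) (G : 𝓢((Fin m → SpaceTime d), ℂ)),
            ⟪SchwingerFamily.OSSpace.vacuum S hS.reflectionPositive, u m G⟫_ℂ = 𝒲 m (fun _ => ()) G)) :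
    OS1973_cluster := by
  intro d _ S hS hE0' 𝒲 h𝒲
  obtain ⟨u, hGram, hcov, hvac⟩ := hu d S hS hE0' 𝒲 h𝒲
  exact h𝒲.hasClusterProperty_of_vectors hS u hGram hcov hvac

end Literature.MathematicalPhysics.QuantumFieldTheory
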